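import Summits.NavierStokesRegularity.NavierStokesRegularity.Theses.PlaneEnergyCeiling
import HarnessLib.Audit

/-!
# Line `radon_topside` for the crux `PlaneEnergyCeiling.BoundedPlanarEnergyRegularity`

(crux item `stmt-NavierStokesRegularity-16921`, route `route-NavierStokesRegularity-PlaneEnergyCeiling`;
tree path `Cruxes/BoundedPlanarEnergyRegularity/Lines/radon_topside.lean`; strategist
`planner-cstrat-stmt-NavierStokesRegularity-16921-b1-0`, 2026-08-17. An ALTERNATIVE to the registered
line `Lines/birth.lean` (local Clay theory + KNSS zoom + Liouville-in-the-planar-class): here NO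
Liouville theorem for ancient solutions is needed; the non-perturbative engine is the
Escauriaza–Seregin–Šverák backward-uniqueness scheme, which is IN TREE
(`ess_backward_uniqueness_holds`, `ess_unique_continuation_holds`, `ckn_epsilon_regularity_holds`,
`ckn_partial_regularity_holds`, the Seregin–Šverák 2002 zoom-at-a-vertex files).)

THE CRUX (Clay (A)-form, per datum). For `ν > 0` and a smooth divergence-free rapidly decaying datum
`u₀`: IF every classical solution `(u,p)` on `ℝ³ × [0,T)` that is Leray–Hopf from `u 0 = u₀` has
planar kinetic energies `∫_{R({x₂=c})} |u(t)|² dA` bounded uniformly in `t < T`, `R`, `c`, THEN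
Clay (A) holds for `u₀`.

THE IDEA (ESS transfer with two new teeth).
* TOOTH 1 — `stub_rieszCeiling` (provable now; Radon back-projection, Helgason, *Geometric Analysis
  on Symmetric Spaces*, Ch. I Thm 2.1 with `n = 3`: the average over all planes through `x` of
  `∫_Π g` equals `½ ∫ g(y)/|x−y| dy`). Slab energies `≤ 2δM` in every direction force the Newtonian
  potential of `|w|²` to be bounded: `sup_x ∫ |w(y)|²/|y−x| dy ≤ 2M`. Applied to the final slice
  `u(T)` (the weak-`L²` limit pinned by `IsLerayHopfOn`), it gives `∫_{B_r(x₀)} |u(T)| = o(r²)`,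
  i.e. the zoomed final slices `λ u(T, x₀ + λ·)` tend to `0` in `L¹_loc` — the final-time
  vanishing step of ESS, which FAILS in the Morrey class `Ṁ^{2,3}` and in `L^{3,∞}` (the
  `|x|⁻¹`-profile is a fixed point of the zoom) but holds in the planar class.
* TOOTH 2 — one-sidedness. ESS needs the zoom limit to be regular outside a large ball near the
  final time (from `∫∫|v|³ + |q|^{3/2} < ∞`); the planar class gives no such far-field control
  (staggered satellite cascades respect every fixed-time budget). But ESS Thm 5.1 is a HALF-SPACE
  theorem: it suffices that the zoom limit be bounded in ONE half-space `{x·e > 1}` near the final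
  time. At the first singular time the blow-up set `Σ_T` is compact (far-field regularity, in tree),
  so it has a TOP point `x₀` in any direction `e`, above which the open half-space is free of
  singular points at time `T`. The load-bearing stub `stub_topsideWindow` upgrades this to a
  quantitative window `|u| ≤ C/λ` on `{⟨y−x₀,e⟩ > λ, |y−x₀| < ρ} × (T − δλ², T)` along a sequence
  `λ → 0` ("no sub-parabolic satellite cascade above a top singular point").
* `stub_essTopsideEndgame` (XL, literature assembly over in-tree facts): planar bound ⇒ Type-I-energy
  bounds at every vertex (Seregin 2006, Lemma 1.8 = in-tree `Seregin2020.scaledEnergies_bounded_of_cknAEss_le`);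
  zoom at `(T,x₀)` along the window scales (`exists_zoom_blowup_limit`); persistence of the
  singularity; final vanishing (Tooth 1); boundedness ⇒ smoothness of the limit in `{x·e>1}×(−δ,0)`;
  `ess_backward_uniqueness` (time-reversed vorticity, half-space) ⇒ `ω ≡ 0` there;
  `ckn_partial_regularity` + `ess_unique_continuation` ⇒ `ω ≡ 0` on a.e. slice; a curl- and
  divergence-free field with `r⁻¹∫_{B_r}|w|² ≤ 2M` is harmonic and zero; contradiction with the
  singular vertex. Conclusion: `x₀` is NOT a backward-singular point.
* `stub_localClayTheory` (M, provable now) — IDENTICAL (name and signature) to the birth line's first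
  stub, deliberately shared: per-datum `NoBlowupToClay`.

COMPOSITION. `BoundedPlanarEnergyRegularity_of_stubs : S_clay → S_riesz → S_window → S_endgame → crux`
(closed, pure logic): feed the local Clay theory; to continue an arbitrary classical Leray–Hopf
`(u,p)` from `u 0 = u₀` past `T` argue by contradiction: the planar hypothesis bounds THIS solution's
planar energies on `[0,T)`, the window stub yields a backward-singular `x₀` with a calm half-space
window, and the endgame stub says such an `x₀` is backward-regular. `BoundedPlanarEnergyRegularity_of`
is the crux BY NAME.

Disproof used: `Cruxes/BoundedPlanarEnergyRegularity/Disproof.lean` (crux-attack cycle 1,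
`refuter-rattack-stmt-NavierStokesRegularity-16921-0`, landed 2026-08-17T09:03Z while this line was being
drafted; NO KILL, no `_false_without_` theorem, no NearMisses). Honoured: its §3 (the Leray–Hopf clause is
load-bearing — the Galilean drift `u = t • e`, `p = −⟪e,x⟫` is classical from the zero datum with
INFINITE planar energy; filed as `Negative/LerayHopfClauseLoadBearing.lean`) — every stub below that
speaks of a solution keeps `IsLerayHopfOn T ν 0 (u 0) u` (stubs 3, 4), and the endgame's zoom uses the
finite-energy class throughout; its §2 (zero datum: instance "true → true") is consistent (no singular
point, stub 3's hypothesis `¬ HasSmoothExtensionPast` fails, stub 4's window holds trivially); its §1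
(`S → C`, `C ↛ S` cheaply) matches the probes recorded in the line card. Negatives index (4055, 1832,
1429, 0154) untouched.
Singularity is INLINED over Mathlib (`∀ r > 0, ∀ K, ∃ t ∈ [0,T), T − r² < t ∧ ∃ y ∈ B_r(x₀), K < ‖u t y‖`;
for the continuous field `u` on `[0,T) × ℝ³` this is `IsBackwardSingularPoint u (T,x₀)` restricted to
the solution's domain), so that the skeleton imports only the route file (cone hygiene: no named-fact
module enters the closure).
-/

noncomputable section

open Set MeasureTheory Filter Topology

namespace Summit.NavierStokesRegularity.NavierStokesRegularity.Cruxes.BoundedPlanarEnergyRegularity.RadonTopside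

set_option linter.unusedVariables false
set_option linter.dupNamespace false

/-- **stub 1 — `stub_localClayTheory` (M; provable now; shared verbatim with `Lines/birth.lean`).**
For `ν > 0` and a smooth, divergence-free, rapidly decaying datum `u₀`: if every classical solution
`(u,p)` of unforced NS on `ℝ³ × [0,T)` that is Leray–Hopf from `u 0 = u₀` extends smoothly past `T`
(all `T > 0`), then Clay (A) holds for `u₀` (per-datum `NoBlowupToClay`, pattern
`Theorems.typeICertificateLadder_noBlowupToClay_proof`). -/
theorem stub_localClayTheory :
    ∀ (ν : ℝ), 0 < ν → ∀ (u₀ : EuclideanSpace ℝ (Fin 3) → EuclideanSpace ℝ (Fin 3)),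
      ContDiff ℝ (⊤ : ℕ∞) u₀ → Literature.Analysis.FluidPDE.NSWave0.IsDivFree u₀ →
      Literature.Analysis.FluidPDE.HasRapidSpatialDecay u₀ →
      (∀ (T : ℝ), 0 < T →
        ∀ (u : ℝ → EuclideanSpace ℝ (Fin 3) → EuclideanSpace ℝ (Fin 3))
          (p : ℝ → EuclideanSpace ℝ (Fin 3) → ℝ),
          Literature.Analysis.FluidPDE.IsClassicalNSSolutionOn (Set.Ico 0 T) ν 0 u p →
          Literature.Analysis.FluidPDE.IsLerayHopfOn T ν 0 (u 0) u → u 0 = u₀ →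
          Literature.Analysis.FluidPDE.HasSmoothExtensionPast ν 0 u T) →
      ∃ (u : ℝ → EuclideanSpace ℝ (Fin 3) → EuclideanSpace ℝ (Fin 3))
        (p : ℝ → EuclideanSpace ℝ (Fin 3) → ℝ),
        Literature.Analysis.FluidPDE.IsSmoothOnHalfSpace u ∧
        Literature.Analysis.FluidPDE.IsSmoothOnHalfSpace p ∧
        Literature.Analysis.FluidPDE.IsNavierStokesSolution ν 0 u₀ u p ∧
        Literature.Analysis.FluidPDE.HasBoundedEnergy u := by
  sorry

/-- **stub 2 — `stub_rieszCeiling` (M; provable now; the Radon back-projection tooth).** If an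
a.e.-strongly measurable field `w` on `ℝ³` has slab energies `∫_{|⟨y,e⟩ − c| < δ} |w|² ≤ 2δM` for every
unit normal `e`, every offset `c` and every half-width `δ > 0` (e.g. a continuous field with planar
energies `≤ M` on every plane, by Tonelli; or a weak-`L²` limit of such fields, by lower
semicontinuity), then the Newtonian potential of `|w|²` is bounded by `2M` at EVERY point:
`∫ |w(y)|² / |y − x| dy ≤ 2M`. Proof: integrate the slab bound over `e ∈ S²`; the band
`{e : |⟨y − x, e⟩| < δ}` has area `4π min(1, δ/|y−x|)`; divide by `δ` and let `δ ↓ 0` (monotone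
convergence); this is the `n = 3` case of the Radon inversion/back-projection identity
(Helgason, Geometric Analysis on Symmetric Spaces, Ch. I, Thm 2.1). The point `y = x` is a null set,
so the `ℝ≥0∞` quotient is harmless. -/
theorem stub_rieszCeiling :
    ∀ (w : EuclideanSpace ℝ (Fin 3) → EuclideanSpace ℝ (Fin 3)),
      MeasureTheory.AEStronglyMeasurable w MeasureTheory.volume →
      ∀ (M : ℝ), 0 ≤ M →
      (∀ (e : EuclideanSpace ℝ (Fin 3)), ‖e‖ = 1 → ∀ (c δ : ℝ), 0 < δ →
        ∫⁻ y in {y : EuclideanSpace ℝ (Fin 3) | c - δ < inner ℝ y e ∧ inner ℝ y e < c + δ},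
            ‖w y‖ₑ ^ 2 ≤ ENNReal.ofReal (2 * δ * M)) →
      ∀ (x : EuclideanSpace ℝ (Fin 3)),
        ∫⁻ y, ‖w y‖ₑ ^ 2 / ENNReal.ofReal ‖y - x‖ ≤ ENNReal.ofReal (2 * M) := by
  sorry

/-- **stub 3 — `stub_topsideWindow` (OPEN — the load-bearing stub; "no sub-parabolic satellite
cascade above a top singular point").** Let `(u,p)` be a classical solution of unforced NS on
`ℝ³ × [0,T)`, Leray–Hopf from its rapidly decaying datum `u 0`, with planar energies bounded on
`[0,T)`, and with NO smooth extension past `T`. Then there are a point `x₀` which is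
backward-singular at time `T` (unbounded on every backward parabolic cylinder below `(T,x₀)`), a unit
direction `e`, and constants `C`, `ρ, δ > 0` such that along a sequence of scales `λ → 0` the field
obeys the ONE-SIDED WINDOW `‖u(t,y)‖ ≤ C/λ` for all `y` with `λ < ⟨y − x₀, e⟩`, `|y − x₀| < ρ` and all
`t ∈ [0,T)` with `T − δλ² < t`. Intended first steps (provable): `¬`extension ⇒ the backward-singular
set `Σ_T` is nonempty (continuation of bounded classical Leray–Hopf solutions,
`hasSmoothExtensionPast_of_bounded_holds`) and compact (far-field regularity,
`IsKatoSolutionOn.farField_bound_holds`); take `x₀ ∈ Σ_T` maximising `⟨·,e⟩` (or the farthest point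
of `Σ_T` from an external point, which is strictly exposed): the open half-space above `x₀` is free
of singular points at time `T`. OPEN content: the quantitative window, i.e. regular points above the
top point do not degenerate sub-parabolically (regularity radius `≥ c·height` along a sequence of
scales); tools to try: localized smoothing / quantitative concentration (Jia–Šverák 2014,
Barker–Prange 2020, Kang–Miura–Tsai 2021) fed with slice-wise disc-energy smallness on the planes
above `x₀`, which are singularity-free at `T` and governed by the route's slab energy law. -/
theorem stub_topsideWindow :
    ∀ (ν T : ℝ), 0 < ν → 0 < T →
      ∀ (u : ℝ → EuclideanSpace ℝ (Fin 3) → EuclideanSpace ℝ (Fin 3))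
        (p : ℝ → EuclideanSpace ℝ (Fin 3) → ℝ),
        Literature.Analysis.FluidPDE.IsClassicalNSSolutionOn (Set.Ico 0 T) ν 0 u p →
        Literature.Analysis.FluidPDE.IsLerayHopfOn T ν 0 (u 0) u →
        Literature.Analysis.FluidPDE.HasRapidSpatialDecay (u 0) →
        (∃ M : ℝ, ∀ t ∈ Set.Ico 0 T,
          ∀ (R : EuclideanSpace ℝ (Fin 3) ≃ₗᵢ[ℝ] EuclideanSpace ℝ (Fin 3)) (c : ℝ),
            ∫⁻ y : EuclideanSpace ℝ (Fin 2), ‖u t (R (WithLp.toLp 2 ![y 0, y 1, c]))‖ₑ ^ 2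
              ≤ ENNReal.ofReal M) →
        ¬ Literature.Analysis.FluidPDE.HasSmoothExtensionPast ν 0 u T →
        ∃ (x₀ e : EuclideanSpace ℝ (Fin 3)), ‖e‖ = 1 ∧
          (∀ r > 0, ∀ (K : ℝ), ∃ t ∈ Set.Ico 0 T, T - r ^ 2 < t ∧
            ∃ y ∈ Metric.ball x₀ r, K < ‖u t y‖) ∧
          ∃ (C ρ δ : ℝ), 0 < ρ ∧ 0 < δ ∧ ∀ l₁ > 0, ∃ l ∈ Set.Ioo 0 l₁,
            ∀ t ∈ Set.Ico 0 T, T - δ * l ^ 2 < t →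
              ∀ (y : EuclideanSpace ℝ (Fin 3)), l < inner ℝ (y - x₀) e → ‖y - x₀‖ < ρ →
                ‖u t y‖ ≤ C / l := by
  sorry

/-- **stub 4 — `stub_essTopsideEndgame` (XL; literature assembly over IN-TREE facts: ESS 2003
Thms 4.1/5.1, CKN ε-regularity and partial regularity, Seregin 2006 Lemma 1.8, the Seregin–Šverák 2002
zoom-at-a-vertex and weak-vanishing files).** Let `(u,p)` be a classical solution of unforced NS on
`ℝ³ × [0,T)`, Leray–Hopf from its rapidly decaying datum, with planar energies `≤ M` on `[0,T)`, and
grant the Riesz ceiling (stub 2, verbatim, as a hypothesis). If at `(x₀, e)` the one-sided window of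
stub 3 holds along a sequence of scales `λ → 0`, then `x₀` is backward-REGULAR at time `T`: `u` is
bounded on some backward cylinder `{T − r² < t < T} × B_r(x₀)`. Route (ν ↦ 1 by scaling):
(1) `A ≤ 2M` at every vertex and scale, hence Type-I-energy bounds `C, D, E ≤ G` (Seregin 2006,
Lemma 1.8; in tree `Seregin2020.scaledEnergies_bounded_of_cknAEss_le`); (2) if `x₀` were
backward-singular, zoom `u^λ(s,x) = λu(T + λ²s, x₀ + λx)` along the window scales: a subsequence
converges in `L³_loc` to a suitable weak solution `w` on `ℝ³ × (−∞,0)` (`exists_zoom_blowup_limit`),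
singular at the vertex (persistence); (3) slab bounds pass to `u(T)` by weak lower semicontinuity,
the Riesz ceiling gives `∫|u(T)|²/|y−x₀| ≤ 2M`, hence `∫_{B_r(x₀)}|u(T)| = o(r²)` and, with the
uniform-in-`λ` modulus of the pairings, `∫⟨w(s),φ⟩ → 0` as `s ↑ 0`; (4) the window makes `w` bounded
by `C` on `{x·e > 1} × (−δ,0)`, hence smooth with bounded derivatives up to `s = 0` on `{x·e > 2} ×
(−δ/2, 0]`, with `ω(0,·) = curl w(0,·) = 0` there; (5) `ess_backward_uniqueness` (time-reversed
vorticity equation `|∂ω + Δω| ≤ c(|ω| + |∇ω|)`, bounded coefficients) ⇒ `ω ≡ 0` on the half-space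
window; (6) `ckn_partial_regularity` (a.e. slice fully regular) + `ess_unique_continuation` ⇒
`ω(s,·) ≡ 0` on `ℝ³` for a.e. `s ∈ (−δ/2,0)`; (7) curl- and divergence-free with
`r⁻¹∫_{B_r}|w(s)|² ≤ 2M` for all `r` ⇒ harmonic ⇒ `w(s) ≡ 0`; so `w = 0` near the vertex,
contradicting (2). -/
theorem stub_essTopsideEndgame :
    ∀ (ν T : ℝ), 0 < ν → 0 < T →
      ∀ (u : ℝ → EuclideanSpace ℝ (Fin 3) → EuclideanSpace ℝ (Fin 3))
        (p : ℝ → EuclideanSpace ℝ (Fin 3) → ℝ),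
        Literature.Analysis.FluidPDE.IsClassicalNSSolutionOn (Set.Ico 0 T) ν 0 u p →
        Literature.Analysis.FluidPDE.IsLerayHopfOn T ν 0 (u 0) u →
        Literature.Analysis.FluidPDE.HasRapidSpatialDecay (u 0) →
        (∃ M : ℝ, ∀ t ∈ Set.Ico 0 T,
          ∀ (R : EuclideanSpace ℝ (Fin 3) ≃ₗᵢ[ℝ] EuclideanSpace ℝ (Fin 3)) (c : ℝ),
            ∫⁻ y : EuclideanSpace ℝ (Fin 2), ‖u t (R (WithLp.toLp 2 ![y 0, y 1, c]))‖ₑ ^ 2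
              ≤ ENNReal.ofReal M) →
        -- the Riesz ceiling (statement of `stub_rieszCeiling`, verbatim):
        (∀ (w : EuclideanSpace ℝ (Fin 3) → EuclideanSpace ℝ (Fin 3)),
          MeasureTheory.AEStronglyMeasurable w MeasureTheory.volume →
          ∀ (M : ℝ), 0 ≤ M →
          (∀ (e : EuclideanSpace ℝ (Fin 3)), ‖e‖ = 1 → ∀ (c δ : ℝ), 0 < δ →
            ∫⁻ y in {y : EuclideanSpace ℝ (Fin 3) | c - δ < inner ℝ y e ∧ inner ℝ y e < c + δ},
                ‖w y‖ₑ ^ 2 ≤ ENNReal.ofReal (2 * δ * M)) →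
          ∀ (x : EuclideanSpace ℝ (Fin 3)),
            ∫⁻ y, ‖w y‖ₑ ^ 2 / ENNReal.ofReal ‖y - x‖ ≤ ENNReal.ofReal (2 * M)) →
        ∀ (x₀ e : EuclideanSpace ℝ (Fin 3)), ‖e‖ = 1 →
        (∃ (C ρ δ : ℝ), 0 < ρ ∧ 0 < δ ∧ ∀ l₁ > 0, ∃ l ∈ Set.Ioo 0 l₁,
            ∀ t ∈ Set.Ico 0 T, T - δ * l ^ 2 < t →
              ∀ (y : EuclideanSpace ℝ (Fin 3)), l < inner ℝ (y - x₀) e → ‖y - x₀‖ < ρ →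
                ‖u t y‖ ≤ C / l) →
        ∃ r > 0, ∃ (K : ℝ), ∀ t ∈ Set.Ico 0 T, T - r ^ 2 < t →
          ∀ y ∈ Metric.ball x₀ r, ‖u t y‖ ≤ K := by
  sorry

/-- **Composition, hypothesis form (closed; pure logic).** The four stub STATEMENTS imply the crux
STATEMENT (spelled out verbatim from `Theses.PlaneEnergyCeiling.BoundedPlanarEnergyRegularity`). -/
theorem BoundedPlanarEnergyRegularity_of_stubs :
    -- S₁: local Clay theory
    (∀ (ν : ℝ), 0 < ν → ∀ (u₀ : EuclideanSpace ℝ (Fin 3) → EuclideanSpace ℝ (Fin 3)),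
      ContDiff ℝ (⊤ : ℕ∞) u₀ → Literature.Analysis.FluidPDE.NSWave0.IsDivFree u₀ →
      Literature.Analysis.FluidPDE.HasRapidSpatialDecay u₀ →
      (∀ (T : ℝ), 0 < T →
        ∀ (u : ℝ → EuclideanSpace ℝ (Fin 3) → EuclideanSpace ℝ (Fin 3))
          (p : ℝ → EuclideanSpace ℝ (Fin 3) → ℝ),
          Literature.Analysis.FluidPDE.IsClassicalNSSolutionOn (Set.Ico 0 T) ν 0 u p →
          Literature.Analysis.FluidPDE.IsLerayHopfOn T ν 0 (u 0) u → u 0 = u₀ →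
          Literature.Analysis.FluidPDE.HasSmoothExtensionPast ν 0 u T) →
      ∃ (u : ℝ → EuclideanSpace ℝ (Fin 3) → EuclideanSpace ℝ (Fin 3))
        (p : ℝ → EuclideanSpace ℝ (Fin 3) → ℝ),
        Literature.Analysis.FluidPDE.IsSmoothOnHalfSpace u ∧
        Literature.Analysis.FluidPDE.IsSmoothOnHalfSpace p ∧
        Literature.Analysis.FluidPDE.IsNavierStokesSolution ν 0 u₀ u p ∧
        Literature.Analysis.FluidPDE.HasBoundedEnergy u) →
    -- S₂: Riesz ceiling
    (∀ (w : EuclideanSpace ℝ (Fin 3) → EuclideanSpace ℝ (Fin 3)),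
      MeasureTheory.AEStronglyMeasurable w MeasureTheory.volume →
      ∀ (M : ℝ), 0 ≤ M →
      (∀ (e : EuclideanSpace ℝ (Fin 3)), ‖e‖ = 1 → ∀ (c δ : ℝ), 0 < δ →
        ∫⁻ y in {y : EuclideanSpace ℝ (Fin 3) | c - δ < inner ℝ y e ∧ inner ℝ y e < c + δ},
            ‖w y‖ₑ ^ 2 ≤ ENNReal.ofReal (2 * δ * M)) →
      ∀ (x : EuclideanSpace ℝ (Fin 3)),
        ∫⁻ y, ‖w y‖ₑ ^ 2 / ENNReal.ofReal ‖y - x‖ ≤ ENNReal.ofReal (2 * M)) →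
    -- S₃: topside window at a singular point
    (∀ (ν T : ℝ), 0 < ν → 0 < T →
      ∀ (u : ℝ → EuclideanSpace ℝ (Fin 3) → EuclideanSpace ℝ (Fin 3))
        (p : ℝ → EuclideanSpace ℝ (Fin 3) → ℝ),
        Literature.Analysis.FluidPDE.IsClassicalNSSolutionOn (Set.Ico 0 T) ν 0 u p →
        Literature.Analysis.FluidPDE.IsLerayHopfOn T ν 0 (u 0) u →
        Literature.Analysis.FluidPDE.HasRapidSpatialDecay (u 0) →
        (∃ M : ℝ, ∀ t ∈ Set.Ico 0 T,
          ∀ (R : EuclideanSpace ℝ (Fin 3) ≃ₗᵢ[ℝ] EuclideanSpace ℝ (Fin 3)) (c : ℝ),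
            ∫⁻ y : EuclideanSpace ℝ (Fin 2), ‖u t (R (WithLp.toLp 2 ![y 0, y 1, c]))‖ₑ ^ 2
              ≤ ENNReal.ofReal M) →
        ¬ Literature.Analysis.FluidPDE.HasSmoothExtensionPast ν 0 u T →
        ∃ (x₀ e : EuclideanSpace ℝ (Fin 3)), ‖e‖ = 1 ∧
          (∀ r > 0, ∀ (K : ℝ), ∃ t ∈ Set.Ico 0 T, T - r ^ 2 < t ∧
            ∃ y ∈ Metric.ball x₀ r, K < ‖u t y‖) ∧
          ∃ (C ρ δ : ℝ), 0 < ρ ∧ 0 < δ ∧ ∀ l₁ > 0, ∃ l ∈ Set.Ioo 0 l₁,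
            ∀ t ∈ Set.Ico 0 T, T - δ * l ^ 2 < t →
              ∀ (y : EuclideanSpace ℝ (Fin 3)), l < inner ℝ (y - x₀) e → ‖y - x₀‖ < ρ →
                ‖u t y‖ ≤ C / l) →
    -- S₄: the half-space endgame
    (∀ (ν T : ℝ), 0 < ν → 0 < T →
      ∀ (u : ℝ → EuclideanSpace ℝ (Fin 3) → EuclideanSpace ℝ (Fin 3))
        (p : ℝ → EuclideanSpace ℝ (Fin 3) → ℝ),
        Literature.Analysis.FluidPDE.IsClassicalNSSolutionOn (Set.Ico 0 T) ν 0 u p →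
        Literature.Analysis.FluidPDE.IsLerayHopfOn T ν 0 (u 0) u →
        Literature.Analysis.FluidPDE.HasRapidSpatialDecay (u 0) →
        (∃ M : ℝ, ∀ t ∈ Set.Ico 0 T,
          ∀ (R : EuclideanSpace ℝ (Fin 3) ≃ₗᵢ[ℝ] EuclideanSpace ℝ (Fin 3)) (c : ℝ),
            ∫⁻ y : EuclideanSpace ℝ (Fin 2), ‖u t (R (WithLp.toLp 2 ![y 0, y 1, c]))‖ₑ ^ 2
              ≤ ENNReal.ofReal M) →
        (∀ (w : EuclideanSpace ℝ (Fin 3) → EuclideanSpace ℝ (Fin 3)),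
          MeasureTheory.AEStronglyMeasurable w MeasureTheory.volume →
          ∀ (M : ℝ), 0 ≤ M →
          (∀ (e : EuclideanSpace ℝ (Fin 3)), ‖e‖ = 1 → ∀ (c δ : ℝ), 0 < δ →
            ∫⁻ y in {y : EuclideanSpace ℝ (Fin 3) | c - δ < inner ℝ y e ∧ inner ℝ y e < c + δ},
                ‖w y‖ₑ ^ 2 ≤ ENNReal.ofReal (2 * δ * M)) →
          ∀ (x : EuclideanSpace ℝ (Fin 3)),
            ∫⁻ y, ‖w y‖ₑ ^ 2 / ENNReal.ofReal ‖y - x‖ ≤ ENNReal.ofReal (2 * M)) →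
        ∀ (x₀ e : EuclideanSpace ℝ (Fin 3)), ‖e‖ = 1 →
        (∃ (C ρ δ : ℝ), 0 < ρ ∧ 0 < δ ∧ ∀ l₁ > 0, ∃ l ∈ Set.Ioo 0 l₁,
            ∀ t ∈ Set.Ico 0 T, T - δ * l ^ 2 < t →
              ∀ (y : EuclideanSpace ℝ (Fin 3)), l < inner ℝ (y - x₀) e → ‖y - x₀‖ < ρ →
                ‖u t y‖ ≤ C / l) →
        ∃ r > 0, ∃ (K : ℝ), ∀ t ∈ Set.Ico 0 T, T - r ^ 2 < t →
          ∀ y ∈ Metric.ball x₀ r, ‖u t y‖ ≤ K) →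
    -- the crux statement, verbatim (cf. `Theses.PlaneEnergyCeiling.BoundedPlanarEnergyRegularity`):
    ∀ (ν : ℝ), 0 < ν → ∀ (u₀ : EuclideanSpace ℝ (Fin 3) → EuclideanSpace ℝ (Fin 3)),
      ContDiff ℝ (⊤ : ℕ∞) u₀ → Literature.Analysis.FluidPDE.NSWave0.IsDivFree u₀ →
      Literature.Analysis.FluidPDE.HasRapidSpatialDecay u₀ →
      (∀ (T : ℝ), 0 < T →
        ∀ (u : ℝ → EuclideanSpace ℝ (Fin 3) → EuclideanSpace ℝ (Fin 3))
          (p : ℝ → EuclideanSpace ℝ (Fin 3) → ℝ),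
          Literature.Analysis.FluidPDE.IsClassicalNSSolutionOn (Set.Ico 0 T) ν 0 u p →
          Literature.Analysis.FluidPDE.IsLerayHopfOn T ν 0 (u 0) u → u 0 = u₀ →
          ∃ M : ℝ, ∀ t ∈ Set.Ico 0 T,
            ∀ (R : EuclideanSpace ℝ (Fin 3) ≃ₗᵢ[ℝ] EuclideanSpace ℝ (Fin 3)) (c : ℝ),
              ∫⁻ y : EuclideanSpace ℝ (Fin 2), ‖u t (R (WithLp.toLp 2 ![y 0, y 1, c]))‖ₑ ^ 2
                ≤ ENNReal.ofReal M) →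
      ∃ (u : ℝ → EuclideanSpace ℝ (Fin 3) → EuclideanSpace ℝ (Fin 3))
        (p : ℝ → EuclideanSpace ℝ (Fin 3) → ℝ),
        Literature.Analysis.FluidPDE.IsSmoothOnHalfSpace u ∧
        Literature.Analysis.FluidPDE.IsSmoothOnHalfSpace p ∧
        Literature.Analysis.FluidPDE.IsNavierStokesSolution ν 0 u₀ u p ∧
        Literature.Analysis.FluidPDE.HasBoundedEnergy u := by
  intro hClay hRiesz hWin hEnd ν hν u₀ hu₀ hdiv hdec hplanar
  -- Step 1 (local Clay theory): it suffices to continue every classical Leray–Hopf `(u,p)` from `u₀`.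
  refine hClay ν hν u₀ hu₀ hdiv hdec ?_
  intro T hT u p hcl hLH h0
  -- Step 2: suppose `(u,p)` did not extend past `T` …
  by_contra hne
  -- … the planar hypothesis bounds the planar energies of THIS solution on `[0,T)` …
  obtain ⟨M, hM⟩ := hplanar T hT u p hcl hLH h0
  have hdec0 : Literature.Analysis.FluidPDE.HasRapidSpatialDecay (u 0) := by
    rw [h0]
    exact hdec
  -- … the window stub produces a backward-singular point with a calm half-space window above it …
  obtain ⟨x₀, e, he, hsing, hwin⟩ := hWin ν T hν hT u p hcl hLH hdec0 ⟨M, hM⟩ hne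
  -- … and the ESS half-space endgame says such a point is backward-regular:
  obtain ⟨r, hr, K, hK⟩ := hEnd ν T hν hT u p hcl hLH hdec0 ⟨M, hM⟩ hRiesz x₀ e he hwin
  obtain ⟨t, ht, htr, y, hy, hKy⟩ := hsing r hr K
  exact absurd (hK t ht htr y hy) (not_le.mpr hKy)

/-- **The skeleton, by name** (the unique theorem of this file concluding the crux decl):
`BoundedPlanarEnergyRegularity` BY NAME, as the closed composition applied to exactly the four
registered stubs (it inherits their placeholders and nothing else). -/
theorem BoundedPlanarEnergyRegularity_of :
    Summit.NavierStokesRegularity.NavierStokesRegularity.Theses.PlaneEnergyCeiling.BoundedPlanarEnergyRegularity :=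
  BoundedPlanarEnergyRegularity_of_stubs stub_localClayTheory stub_rieszCeiling stub_topsideWindow
    stub_essTopsideEndgame

end Summit.NavierStokesRegularity.NavierStokesRegularity.Cruxes.BoundedPlanarEnergyRegularity.RadonTopside

end
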